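import Summits.BirchSwinnertonDyer.BirchSwinnertonDyer.Theses.EisensteinDepletionAtTwo
import Literature.NumberTheory.EllipticCurves.IsogenyFrobeniusTraceHoldsProofs
import Literature.NumberTheory.EllipticCurves.EichlerShimuraConstruction
import Literature.NumberTheory.EllipticCurves.ShimuraSubgroupHeckeCongruence
import Summits.BirchSwinnertonDyer.BirchSwinnertonDyer.Theorems.EisensteinDepletionAtTwoStarOptBNSFStubLevelDetect
import Summits.BirchSwinnertonDyer.BirchSwinnertonDyer.Theorems.EisensteinDepletionAtTwoStarOptBNSFStubIsogenyFactor
import Summits.BirchSwinnertonDyer.BirchSwinnertonDyer.Theorems.EisensteinDepletionAtTwoStarOptBNSFStubOddIsoArch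
import Summits.BirchSwinnertonDyer.BirchSwinnertonDyer.Theorems.EisensteinDepletionAtTwoStarOptBNSFStubTwoPowerWalk
import Summits.BirchSwinnertonDyer.BirchSwinnertonDyer.Theorems.EisensteinDepletionAtTwoStarOptBNSFStubOddIsoTwoAdic
import Summits.BirchSwinnertonDyer.BirchSwinnertonDyer.Theorems.EisensteinDepletionAtTwoStarOptBTwoTorsionOfIsogenous
import Summits.BirchSwinnertonDyer.BirchSwinnertonDyer.Theorems.EisensteinDepletionAtTwoStarOptBNSFTwoAdicDictionary
import Summits.BirchSwinnertonDyer.BirchSwinnertonDyer.Theorems.ByReductionTypeAtTwoOrdIsogenyRescale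
import Summits.BirchSwinnertonDyer.BirchSwinnertonDyer.Theorems.EisensteinDepletionAtTwoStarOptBNSFOddShimuraCover
import Summits.BirchSwinnertonDyer.BirchSwinnertonDyer.Theorems.EisensteinDepletionAtTwoStarOptBNSFStevensAtTwoOfPE0
import Summits.BirchSwinnertonDyer.BirchSwinnertonDyer.Theorems.EisensteinDepletionAtTwoStarOptBNSFX1OptimalOfModularity
import Summits.BirchSwinnertonDyer.BirchSwinnertonDyer.Theorems.EisensteinDepletionAtTwoStarOptBNSFCongruenceCore
import Summits.BirchSwinnertonDyer.BirchSwinnertonDyer.Theorems.EisensteinDepletionAtTwoStarOptBNSFParityGroup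
import Literature.NumberTheory.EllipticCurves.TwoTorsionHalfPeriodProofs
import Summits.BirchSwinnertonDyer.BirchSwinnertonDyer.Theorems.EisensteinDepletionAtTwoStarOptBNSFFormalSqrtAtTwo
import Summits.BirchSwinnertonDyer.BirchSwinnertonDyer.Theorems.EisensteinDepletionAtTwoStarOptBNSFGamma1Bounded
import Summits.BirchSwinnertonDyer.BirchSwinnertonDyer.Theorems.EisensteinDepletionAtTwoStarOptBNSFParamIntegral
import Summits.BirchSwinnertonDyer.BirchSwinnertonDyer.Theorems.EisensteinDepletionAtTwoStarOptBNSFParamExpansion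
import Summits.BirchSwinnertonDyer.BirchSwinnertonDyer.Theorems.EisensteinDepletionAtTwoStarOptBNSFKummerAlg
import Summits.BirchSwinnertonDyer.BirchSwinnertonDyer.Theorems.EisensteinDepletionAtTwoStarOptBNSFKummerQExp
import Summits.BirchSwinnertonDyer.BirchSwinnertonDyer.Theorems.EisensteinDepletionAtTwoStarOptBNSFKummerFn
import Summits.BirchSwinnertonDyer.BirchSwinnertonDyer.Theorems.EisensteinDepletionAtTwoStarOptBNSFKummerForm
import Summits.BirchSwinnertonDyer.BirchSwinnertonDyer.Theorems.EisensteinDepletionAtTwoStarOptBNSFX1Denominator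
import HarnessLib

/-!
# Line `nsf`, end state I: «Stevens at 2» for the `X₁(N)`-type curve, modulo unbounded denominators (crux `StarOptBNSF`, stmt-BirchSwinnertonDyer-27047)

Lead star-p1 GEN 12.  Distillation of the registered skeleton `Cruxes/StarOptBNSF/Lines/nsf` v22 (every non-print stub a tree
theorem) into landed theorems, part 1 of 2: the monolithic S3 statement `sqrtCuspForm` (assembled from the landed stubs S3-K/X/U/Q/A),
the weight-free parity-cover statement `parityCoverWt` (S1, S2a, S2b, S4 consumed), and `stevensAtTwoX1Int` — no formal rational
2-torsion point on `W₁` — under the single named fact `CalegariDimitrovTang2025_unboundedDenominators`.  No `sorry`, no new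
definition; nothing here reads `r_an`; BSD is not proved by this file.
-/

set_option linter.dupNamespace false
set_option autoImplicit false

noncomputable section

namespace Summit.BirchSwinnertonDyer.BirchSwinnertonDyer.Theorems.DepletionAtTwo.NsfDoor

open scoped MatrixGroups ModularForm
open Literature.NumberTheory.EllipticCurves
open Literature.NumberTheory.EllipticCurves.Greenberg1999
open Literature.NumberTheory.EllipticCurves.ModularForms

/-- **The anti-invariant cusp form of a formal rational 2-torsion point** (monolith S3 of line `nsf`, now a theorem): from the
Kummer function (`…KummerFn`), the rational `Γ₁(N)`-denominator (`…X1Denominator`), the Kummer form (`…KummerForm`), the `q`-expansion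
identities (`…KummerQExp`) and the formal algebra (`…KummerAlg`) — given the formal square root `B`, the integral parameter expansion
`z(q)` and bounded denominators on `Γ₁(N)` as data. [cite: ShimuraIATAF1971, §2.4 and Thm. 7.14] [cite: SilvermanAEC2009, VI.3.6] -/
theorem sqrtCuspForm :
    ∀ (W₁ : WeierstrassCurve ℚ) [W₁.IsElliptic] [W₁.IsGloballyMinimal]
      ⦃N : ℕ⦄ [NeZero N] (f : CuspForm (CongruenceSubgroup.Gamma0 N) 2), IsNewformOf W₁ f →
      ∀ (L₁ : PeriodPair), IsNeronLatticeOf (W₁.baseChange ℂ) L₁ →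
      ∀ (c₁ : ℚ), c₁ ≠ 0 → (∀ z ∈ periodLatticeGamma1 f, (c₁ : ℂ) * z ∈ L₁.lattice) →
      (∀ z ∈ L₁.lattice, ∃ w ∈ periodLatticeGamma1 f, z = (c₁ : ℂ) * w) →
      ∀ (x₁ : ℚ), HasRationalTwoTorsionX W₁ x₁ →
      ∀ (lam : ℂ), lam ∈ L₁.lattice → lam / 2 ∉ L₁.lattice →
        L₁.weierstrassP (lam / 2) - ((W₁.b₂ : ℚ) : ℂ) / 12 = ((x₁ : ℚ) : ℂ) →
        ∀ (Γ' : Subgroup SL(2, ℤ)),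
          (∀ γ : SL(2, ℤ), γ ∈ Γ' ↔ ∃ hγ : γ ∈ CongruenceSubgroup.Gamma0 N, γ ∈ CongruenceSubgroup.Gamma1 N ∧
            ∃ k : ℤ, ∃ w ∈ L₁.lattice, (c₁ : ℂ) * cuspSymbol f ⟨γ, hγ⟩ = (k : ℂ) * lam + 2 * w) →
          -- (S1) the formal square root with coefficients in `½ℤ`
          ∀ (B : PowerSeries ℚ), PowerSeries.constantCoeff B = 1 →
            B ^ 2 = W₁.formalXMulSq - PowerSeries.C x₁ * PowerSeries.X ^ 2 →
            (∀ n : ℕ, ∃ k : ℤ, PowerSeries.coeff n B = (k : ℚ) / 2) →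
          -- (S2) the integral expansion of the formal parameter along the parametrisation
          ∀ (zq : PowerSeries ℤ), PowerSeries.constantCoeff zq = 0 → PowerSeries.coeff 1 zq ≠ 0 →
            (∃ A : ℝ, ∀ τ : UpperHalfPlane, A < τ.im →
          HasSum (fun n : ℕ ↦ ((PowerSeries.coeff n zq : ℤ) : ℂ) *
              Complex.exp (2 * Real.pi * Complex.I * (τ : ℂ)) ^ n)
            (-(L₁.weierstrassP ((c₁ : ℂ) * eichlerIntegral f τ) - ((W₁.b₂ : ℚ) : ℂ) / 12) /
              ((L₁.derivWeierstrassP ((c₁ : ℂ) * eichlerIntegral f τ)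
                - ((W₁.a₁ : ℚ) : ℂ) * (L₁.weierstrassP ((c₁ : ℂ) * eichlerIntegral f τ) - ((W₁.b₂ : ℚ) : ℂ) / 12)
                - ((W₁.a₃ : ℚ) : ℂ)) / 2))) →
          -- (S4) bounded denominators of rational cusp forms on `Γ₁(N)` (weights `k ≥ 1`; a tree theorem for `N ≥ 5`)
          (∀ (k : ℤ), 1 ≤ k → ∀ (F : CuspForm (CongruenceSubgroup.Gamma1 N) k),
        (∀ n : ℕ, ∃ r : ℚ, PowerSeries.coeff n (UpperHalfPlane.qExpansion (1 : ℝ) F) = (r : ℂ)) →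
        ∃ D : ℕ, D ≠ 0 ∧ ∀ n : ℕ, ∃ z : ℤ,
          PowerSeries.coeff n
            (UpperHalfPlane.qExpansion (1 : ℝ) (fun τ : UpperHalfPlane ↦ (D : ℂ) * F τ)) = (z : ℂ)) →
          ∃ (k : ℤ) (h : CuspForm Γ' k) (M : ℕ),
            (h : UpperHalfPlane → ℂ) ≠ 0 ∧
            (∀ γ ∈ CongruenceSubgroup.Gamma1 N, γ ∉ Γ' → (h : UpperHalfPlane → ℂ) ∣[k] γ = -h) ∧
            M ≠ 0 ∧
            ∀ n : ℕ, ∃ z : ℤ,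
              PowerSeries.coeff n
                (UpperHalfPlane.qExpansion (1 : ℝ) (fun τ : UpperHalfPlane ↦ (M : ℂ) * h τ)) = (z : ℂ) := by
  intro W₁ _ _ N _ f hW₁ L₁ hL₁ c₁ hc₁ hin hout x₁ hx₁ lam hlam hlam2 hwp Γ' hΓ B hB0 hBsq hBhalf zq hz0 hz1 hzsum hS4
  obtain ⟨g, hg1, hg2, hg3⟩ :=
    Summit.BirchSwinnertonDyer.BirchSwinnertonDyer.Theorems.DepletionAtTwo.KummerFn.stub_kummerFn L₁ lam hlam hlam2
  obtain ⟨k, G₁, Φ₁, hk, hG0, hGrat, hΦ⟩ :=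
    Summit.BirchSwinnertonDyer.BirchSwinnertonDyer.Theorems.DepletionAtTwo.X1Denominator.stub_x1Denominator W₁ f hW₁ L₁ hL₁ c₁ hc₁ hin
  obtain ⟨h, hh0, hanti, hsq⟩ :=
    Summit.BirchSwinnertonDyer.BirchSwinnertonDyer.Theorems.DepletionAtTwo.KummerForm.stub_kummerForm W₁ f hW₁ L₁ hL₁ c₁ hc₁ hin
      x₁ lam hlam hlam2 hwp Γ' hΓ g hg1 hg2 hg3 k G₁ Φ₁ hG0 hΦ
  have hT1 : ModularGroup.T ∈ CongruenceSubgroup.Gamma1 N := by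
    rw [CongruenceSubgroup.Gamma1_mem]
    simp [ModularGroup.T]
  have hTtr : ((ModularGroup.T : SL(2, ℤ)) : Matrix (Fin 2) (Fin 2) ℤ).trace = 2 := by
    simp [ModularGroup.T, Matrix.trace_fin_two]
  have hT : ModularGroup.T ∈ Γ' :=
    Summit.BirchSwinnertonDyer.BirchSwinnertonDyer.Theorems.DepletionAtTwo.ParityGroup.mem_of_trace_eq_two
      f L₁ c₁ lam hΓ hT1 hTtr
  obtain ⟨hi, hii, hlinh, hlinΦ⟩ :=
    Summit.BirchSwinnertonDyer.BirchSwinnertonDyer.Theorems.DepletionAtTwo.KummerQExp.stub_kummerQExp W₁ f hW₁ L₁ hL₁ c₁ hc₁ x₁ B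
      hB0 hBsq zq hz0 hz1 hzsum k G₁ Φ₁ hΦ Γ' hT h hsq
  obtain ⟨hΦrat, hint⟩ :=
    Summit.BirchSwinnertonDyer.BirchSwinnertonDyer.Theorems.DepletionAtTwo.KummerAlg.stub_kummerAlg W₁ B hB0 hBhalf zq hz0 hz1
      _ _ _ hGrat hi hii
  obtain ⟨D, hD0, hDint⟩ := hS4 k hk Φ₁ hΦrat
  refine ⟨k, h, 2 * D, hh0, hanti, by positivity, fun n ↦ ?_⟩
  have hDint' : ∀ n : ℕ, ∃ z : ℤ, PowerSeries.coeff n (PowerSeries.C (D : ℂ) * UpperHalfPlane.qExpansion (1 : ℝ) Φ₁) = (z : ℂ) := by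
    intro m
    rw [← hlinΦ (D : ℂ)]
    exact hDint m
  obtain ⟨z, hz⟩ := hint D hD0 hDint' n
  refine ⟨z, ?_⟩
  rw [hlinh, hz]


/-- **The weight-free parity-cover statement** (line `nsf`, A″): the parity cover `Γ′` of a FORMAL rational 2-torsion point of the
`X₁(N)`-type curve `W₁` (integer Manin constant) carries a non-zero cusp form, anti-invariant under `Γ₁(N) ∖ Γ′`, with an integral
multiple at `∞` — `sqrtCuspForm` fed with the formal square root (`…FormalSqrtAtTwo`), Honda at every prime (`…ParamIntegral`), the
parameter expansion (`…ParamExpansion`) and bounded denominators on `Γ₁(N)` (`…Gamma1Bounded`, `N ≥ 11`). [cite: SilvermanAEC2009, IV.1, VI.3.6] -/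
theorem parityCoverWt :
    ∀ (W₁ : WeierstrassCurve ℚ) [W₁.IsElliptic] [W₁.IsGloballyMinimal]
      ⦃N : ℕ⦄ [NeZero N] (f : CuspForm (CongruenceSubgroup.Gamma0 N) 2), IsNewformOf W₁ f →
      ¬ 2 ∣ N → (∃ p : ℕ, p.Prime ∧ p ∣ N ∧ cuspCoeff f p = 0) → IsOrdinaryAt W₁ 2 →
      ∀ (L₁ : PeriodPair), IsNeronLatticeOf (W₁.baseChange ℂ) L₁ →
      ∀ (c₁ : ℚ), c₁ ≠ 0 → (∀ z ∈ periodLatticeGamma1 f, (c₁ : ℂ) * z ∈ L₁.lattice) →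
      (∀ z ∈ L₁.lattice, ∃ w ∈ periodLatticeGamma1 f, z = (c₁ : ℂ) * w) →
      (∃ m : ℤ, (m : ℚ) = c₁) →
      ∀ (x₁ : ℚ), HasRationalTwoTorsionX W₁ x₁ → TwoTorsionRamifiedAtTwo x₁ →
      ∀ (lam : ℂ), lam ∈ L₁.lattice → lam / 2 ∉ L₁.lattice →
        L₁.weierstrassP (lam / 2) - ((W₁.b₂ : ℚ) : ℂ) / 12 = ((x₁ : ℚ) : ℂ) →
        ∀ (Γ' : Subgroup SL(2, ℤ)),
          (∀ γ : SL(2, ℤ), γ ∈ Γ' ↔ ∃ hγ : γ ∈ CongruenceSubgroup.Gamma0 N, γ ∈ CongruenceSubgroup.Gamma1 N ∧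
            ∃ k : ℤ, ∃ w ∈ L₁.lattice, (c₁ : ℂ) * cuspSymbol f ⟨γ, hγ⟩ = (k : ℂ) * lam + 2 * w) →
          ∃ (k : ℤ) (h : CuspForm Γ' k) (M : ℕ),
            (h : UpperHalfPlane → ℂ) ≠ 0 ∧
            (∀ γ ∈ CongruenceSubgroup.Gamma1 N, γ ∉ Γ' → (h : UpperHalfPlane → ℂ) ∣[k] γ = -h) ∧
            M ≠ 0 ∧
            ∀ n : ℕ, ∃ z : ℤ,
              PowerSeries.coeff n
                (UpperHalfPlane.qExpansion (1 : ℝ) (fun τ : UpperHalfPlane ↦ (M : ℂ) * h τ)) = (z : ℂ) := by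
  intro W₁ _ _ N _ f hW₁ _ _ _ L₁ hL₁ c₁ hc₁ hin hout hint x₁ hx₁ hram lam hlam hlam2 hwp Γ' hΓ
  have hZ := Summit.BirchSwinnertonDyer.BirchSwinnertonDyer.Theorems.DepletionAtTwo.ParamExpansion.stub_paramExpansion
  -- the level of a newform of an elliptic curve is at least `11`
  have h11 : 11 ≤ N := by
    by_contra hlt
    have hf0 : f = 0 := cuspForm_two_gamma0_eq_zero_of_le_ten (by omega) f
    have h1 : cuspCoeff f 1 = (W₁.LFunction 1 : ℂ) := hW₁.2 1
    rw [hf0, WeierstrassCurve.LFunction_apply_one] at h1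
    have h0 : cuspCoeff (0 : CuspForm (CongruenceSubgroup.Gamma0 N) 2) 1 = 0 :=
      (cuspCoeffₗ (one_mem_strictPeriods_coe_gamma0 N) 1).map_zero
    rw [h0] at h1
    norm_num at h1
  -- S1 (closed): the formal square root with coefficients in `½ℤ`
  obtain ⟨B, hB0, hBsq, hBhalf⟩ :=
    Summit.BirchSwinnertonDyer.BirchSwinnertonDyer.Theorems.DepletionAtTwo.FormalSqrt.exists_formalSqrt_half_integral W₁ hx₁ hram
  -- the integer Manin constant
  obtain ⟨m, hm⟩ := hint
  subst hm
  -- S2a (closed): the integer series `Z = exp(m·ℓ)`; S2b: it is the expansion of `−x/y`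
  choose k hk using Summit.BirchSwinnertonDyer.BirchSwinnertonDyer.Theorems.DepletionAtTwo.ParamIntegral.stub_paramIntegralFormal W₁ m
  obtain ⟨hZ0, hZ1, A, hA⟩ := hZ W₁ f hW₁ L₁ hL₁ (m : ℚ) hc₁
  set zq : PowerSeries ℤ := PowerSeries.mk k with hzq
  have hz0 : PowerSeries.constantCoeff zq = 0 := by
    have h := hk 0
    rw [PowerSeries.coeff_zero_eq_constantCoeff, hZ0] at h
    rw [hzq, ← PowerSeries.coeff_zero_eq_constantCoeff_apply, PowerSeries.coeff_mk]
    exact_mod_cast h.symm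
  have hz1 : PowerSeries.coeff 1 zq ≠ 0 := by
    have h := hk 1
    rw [hZ1] at h
    rw [hzq, PowerSeries.coeff_mk]
    intro h0
    rw [h0, Int.cast_zero] at h
    exact hc₁ h
  have hzexp : ∃ A : ℝ, ∀ τ : UpperHalfPlane, A < τ.im →
      HasSum (fun n : ℕ ↦ ((PowerSeries.coeff n zq : ℤ) : ℂ) *
          Complex.exp (2 * Real.pi * Complex.I * (τ : ℂ)) ^ n)
        (-(L₁.weierstrassP (((m : ℚ) : ℂ) * eichlerIntegral f τ) - ((W₁.b₂ : ℚ) : ℂ) / 12) /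
          ((L₁.derivWeierstrassP (((m : ℚ) : ℂ) * eichlerIntegral f τ)
            - ((W₁.a₁ : ℚ) : ℂ) * (L₁.weierstrassP (((m : ℚ) : ℂ) * eichlerIntegral f τ) - ((W₁.b₂ : ℚ) : ℂ) / 12)
            - ((W₁.a₃ : ℚ) : ℂ)) / 2)) := by
    refine ⟨A, fun τ hτ ↦ ?_⟩
    have hfun : (fun n : ℕ ↦ ((PowerSeries.coeff n zq : ℤ) : ℂ) * Complex.exp (2 * Real.pi * Complex.I * (τ : ℂ)) ^ n) =
        fun n : ℕ ↦ ((PowerSeries.coeff n (W₁.formalExp.subst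
          (((m : ℤ) : ℚ) • (PowerSeries.mk fun j : ℕ ↦ ((W₁.LFunction j : ℤ) : ℚ) / j))) : ℚ) : ℂ) *
            Complex.exp (2 * Real.pi * Complex.I * (τ : ℂ)) ^ n := by
      funext n
      rw [hk n, hzq, PowerSeries.coeff_mk, Rat.cast_intCast]
    rw [hfun]
    exact hA τ hτ
  -- S3 with S4 (closed, `N ≥ 5`)
  exact sqrtCuspForm W₁ f hW₁ L₁ hL₁ (m : ℚ) hc₁ hin hout x₁ hx₁ lam hlam hlam2 hwp Γ' hΓ B hB0 hBsq hBhalf zq hz0 hz1 hzexp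
    (Summit.BirchSwinnertonDyer.BirchSwinnertonDyer.Theorems.DepletionAtTwo.Gamma1Bounded.stub_gamma1Bounded N (by omega))


/-- **«Stevens at 2» with an integer Manin constant, modulo UBD**: the `X₁(N)`-type curve `W₁` of an odd level with a traceless
prime, good ordinary at `2`, has no FORMAL rational 2-torsion point — the parity cover's anti-invariant integral cusp form contradicts
the unbounded denominators theorem through the tree's congruence core (`…CongruenceCore.false_of_antiinvariant_integral_cuspForm_wt`).
[cite: Stevens1989, §2] [cite: CalegariDimitrovTang2025, Thm. 1.0.1] -/
theorem stevensAtTwoX1Int (hU : Literature.NumberTheory.Automorphic.CalegariDimitrovTang2025_unboundedDenominators) :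
    ∀ (W₁ : WeierstrassCurve ℚ) [W₁.IsElliptic] [W₁.IsGloballyMinimal]
      ⦃N : ℕ⦄ [NeZero N] (f : CuspForm (CongruenceSubgroup.Gamma0 N) 2), IsNewformOf W₁ f →
      ¬ 2 ∣ N → (∃ p : ℕ, p.Prime ∧ p ∣ N ∧ cuspCoeff f p = 0) → IsOrdinaryAt W₁ 2 →
      ∀ (L₁ : PeriodPair), IsNeronLatticeOf (W₁.baseChange ℂ) L₁ →
      ∀ (c₁ : ℚ), c₁ ≠ 0 → (∀ z ∈ periodLatticeGamma1 f, (c₁ : ℂ) * z ∈ L₁.lattice) →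
      (∀ z ∈ L₁.lattice, ∃ w ∈ periodLatticeGamma1 f, z = (c₁ : ℂ) * w) →
      (∃ m : ℤ, (m : ℚ) = c₁) →
      ∀ (x₁ : ℚ), HasRationalTwoTorsionX W₁ x₁ → ¬ TwoTorsionRamifiedAtTwo x₁ := by
  intro W₁ _ _ N _ f hW₁ hodd hp hord L₁ hL₁ c₁ hc₁ hin hout hint x₁ hx₁ hram
  obtain ⟨lam, hlam, hlam2, hwp⟩ :=
    Literature.NumberTheory.EllipticCurves.exists_half_period_of_hasRationalTwoTorsionX W₁ L₁ hL₁ hx₁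
  have hcover := parityCoverWt W₁ f hW₁ hodd hp hord L₁ hL₁ c₁ hc₁ hin hout hint x₁ hx₁ hram lam hlam hlam2 hwp
  obtain ⟨Γ', hΓ⟩ :=
    Summit.BirchSwinnertonDyer.BirchSwinnertonDyer.Theorems.DepletionAtTwo.ParityGroup.exists_parityGroup f L₁ c₁ hin hlam hlam2
  obtain ⟨k, h, M, hh, hanti, hM, hint'⟩ := hcover Γ' hΓ
  haveI : Γ'.FiniteIndex :=
    Summit.BirchSwinnertonDyer.BirchSwinnertonDyer.Theorems.DepletionAtTwo.ParityGroup.finiteIndex_of_parity f L₁ c₁ hin hlam hlam2 hΓ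
  have hpar : ∀ γ ∈ CongruenceSubgroup.Gamma1 N, (γ : Matrix (Fin 2) (Fin 2) ℤ).trace = 2 → γ ∈ Γ' :=
    fun γ hγ htr ↦
      Summit.BirchSwinnertonDyer.BirchSwinnertonDyer.Theorems.DepletionAtTwo.ParityGroup.mem_of_trace_eq_two f L₁ c₁ lam hΓ hγ htr
  have hne : ∃ γ₀ ∈ CongruenceSubgroup.Gamma1 N, γ₀ ∉ Γ' :=
    Summit.BirchSwinnertonDyer.BirchSwinnertonDyer.Theorems.DepletionAtTwo.ParityGroup.exists_mem_gamma1_notMem f L₁ c₁ hin hlam hlam2 hΓ hout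
  exact Summit.BirchSwinnertonDyer.BirchSwinnertonDyer.Theorems.DepletionAtTwo.CongruenceCore.false_of_antiinvariant_integral_cuspForm_wt
    hU (NeZero.ne N) hpar hne h hh hanti hM hint'

end Summit.BirchSwinnertonDyer.BirchSwinnertonDyer.Theorems.DepletionAtTwo.NsfDoor

end
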